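import Summits.CriticalPhenomena.PercolationContinuityZ3.Theorems.PercNearOneGluingNoHeavyConstsLinearLowerTailGluedBlock
import HarnessLib

/-!
# (LT³⁄₂) for two glued blocks carrying all but at most "half of themselves plus one and a half" of the relay set, any observer

builds on p205010 (kernel theorem, internal audit signed; external expert review pending)

PAPER-2 track "percolation constants", part (ii), seat `prim-consts-1`, gen 11 (lane index `run/shared/lean/prim/consts/CONSTANTS.md`,
row A19; memo `FROM-prim-consts-1-g11-GLUED-BLOCK.md`).  Support file for the crux `NoHeavyLowerTail` (stmt-CriticalPhenomena-4575;
`--supports`): theorems only, no definitions, no sorries, standard axioms.  Sequel to `…ConstsLinearLowerTailGluedBlock`.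

Notation: finite weighted graph on `Fin n` (`μ = prodBernoulli w`), relay set `A`, observer `o` (no hypothesis), `N = |C(o) ∩ A|`,
`EN = Σ_{a∈A} P(o ↔ a) ≤ |A|`, `s ≥ max_{a,a'∈A} P(a ↮ a')`, bad event `{1 ≤ N < κ·EN}`, `0 < κ ≤ 2/3`; block count
`N_a = |{b ∈ A : a ↔ b}|`.  GLUED BLOCKS: disjoint nonempty `B₁, B₂ ⊆ A` with `P(t₁ ↮ b) = 0` on `B₁` and `P(t₂ ↮ b) = 0` on `B₂` for
two vertices `t₁, t₂` (in `A` or not; a block may be a single relay point, glued to itself); FREE PART `F = A ∖ (B₁ ∪ B₂)`.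

THE THEOREM.  **If `2·|F| ≤ |B₁| + |B₂| + 3` then `P(1 ≤ N < κ·EN) ≤ (3/2)·s` for every observer and every `0 < κ ≤ 2/3`.**
Equivalently: the two blocks together with one further relay point carry at least `⌈2|A|/3⌉` points.  Consequences in the same file:
ONE glued block `B` with `2·|A ∖ B| ≤ |B| + 6` (take `B₂` = a free singleton) — which contains `…GluedBlock` (`|A ∖ B| ≤ 4`).
Comparison with the glued-fraction theorem (`…GluedFraction`: two marked points whose glued sets carry `κ·EN`, constant `3/2`, where
`3/2` is ATTAINED): when `EN` is close to `|A|` that needs `|B₁| + |B₂| ≥ 2|F|`; the present file allows THREE MORE free points,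
uniformly in the block sizes (and needs no assignment bookkeeping), at the price of exact gluing (defect `η = 0`).  Examples newly
covered: blocks of sizes `3, 3` plus `4` free points wired arbitrarily (`|A| = 10`, `EN` up to `10`); one block of `20` plus `13` free
points; `|B₁| = |B₂| = m` plus `m + 1` free points for every `m`.

THE PROOF is elementary given two tools already in the tree: (1) the footprint transfer `Consts.lowerTail_le_blockDeficit` (the
master inequality (GEN) at the threshold functional): `μ(1 ≤ N_o < k) ≤ μ(o ↔ A)·max_{a∈A} μ(N_a < k)`, used at
`k = |A| − ⌊|A|/3⌋ = ⌈2|A|/3⌉ ≥ κ·EN`, so that `N_a < k` means "`a` loses at least `L₀ = ⌊|A|/3⌋ + 1` relay points"; (2) the bound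
`μ(a ↮ y or a ↮ z) ≤ (3/2)s` for relay points `a, y, z` (sum of the three pairwise budgets, halved) — used here through the repeated-entry
case `(y,y,z,z)` of the five-point lemma as packaged in `Consts.real_le_three_halves_of_two_lost_ae` (so vdBHK Thm. 1.3, although on the
import path, is NOT needed for this class; the same remark applies to `…GluedBlock`).  Off the glue null set each block is kept or
lost as a whole and `a` keeps its own block; the hypothesis says exactly `L₀ ≥ |F|`, hence: `a ∈ B₁` loses `B₂` or ALL of `F` (so a
fixed `y ∈ F`); `a ∈ B₂` symmetrically; `a ∈ F` cannot lose `L₀ > |F ∖ {a}|` points without losing a block, so it loses `B₁` or `B₂`.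
* `Consts.real_blockDeficit_two_blocks_le` — the block-deficit bound `μ(N_a < k) ≤ (3/2)s` at every `a ∈ A` (`k + |F| ≤ |A| + 1`,
  `k ≤ |A|`).
* `Consts.real_lowerTail_le_three_halves_of_two_glued_blocks` — **(LT³⁄₂) for the class `2|F| ≤ |B₁| + |B₂| + 3`**.
* `Consts.real_lowerTail_le_three_halves_of_glued_block_half` — one block, `2·|A ∖ B| ≤ |B| + 6`.
* `Consts.linearLowerTailThreeHalves_of_two_glued_blocks`, `Consts.linearLowerTailThreeHalves_of_glued_block_half` — the same in the
  quantifier shape of `Consts.LinearLowerTailThreeHalves` (free points = those with positive detachment probability from both / from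
  the anchor).
LIMITS (memo g11 §1): a third heavy block, or more free points, make some block deficit a genuine "two of four distinct blocks" event
(the five-point lemma proper, vdBHK) or a weighted five-point event `(2,1,1,1; θ = 2)` whose admissibility is open (coin pseudo-law
value exactly `3/2`); e.g. blocks `4,4,4` with three free points ARE five-point-coverable (successor), block `3` with five free points
is not.
References: G. Kozma, N. Nitzan, arXiv:2401.12397 (2024), Conjecture 1 (p. 3), Conjecture 4 (p. 32); G. Grimmett, *Percolation*
(1999), §1.3.
-/

noncomputable section

namespace Summit.CriticalPhenomena.PercolationContinuityZ3.Theorems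

open MeasureTheory Set Literature.Probability.LatticeModels Literature.Probability.Percolation
open scoped Classical

namespace Consts

/-! ### Block deficits next to two glued blocks -/

/-- Counting step for two blocks.  If `B₁, B₂ ⊆ A` are disjoint, every point of `B₁ ∪ B₂` is joined to `a`, and `a` keeps fewer than
`k` relay points, then the relay points cut from `a` form a subset of `A ∖ (B₁ ∪ B₂)` not containing `a`, of size at least
`|A| + 1 − k`. [folklore] -/
theorem lostSet_sub_free_of_blocks_kept {n : ℕ} (A B₁ B₂ : Finset (Fin n)) (a : Fin n) (ω : BondConfig (Fin n))
    (hB : ∀ b ∈ B₁ ∪ B₂, ω ∈ openConn a b) (k : ℕ) (hN : (A.filter fun b => ω ∈ openConn a b).card < k) :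
    (A.filter fun b => ω ∉ openConn a b) ⊆ (A \ (B₁ ∪ B₂)).erase a ∧
      A.card + 1 ≤ (A.filter fun b => ω ∉ openConn a b).card + k := by
  constructor
  · intro b hb
    have hb' := Finset.mem_filter.1 hb
    refine Finset.mem_erase.2 ⟨?_, Finset.mem_sdiff.2 ⟨hb'.1, fun hbB => hb'.2 (hB b hbB)⟩⟩
    rintro rfl
    exact hb'.2 (SimpleGraph.Reachable.refl _)
  · have hsplit := Finset.card_filter_add_card_filter_not (s := A) (fun b => ω ∈ openConn a b)
    omega

/-- **Block deficit next to two glued blocks.**  Disjoint nonempty `B₁, B₂ ⊆ A`, almost surely glued to `t₁`, resp. `t₂`; free part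
`F = A ∖ (B₁ ∪ B₂)`; all pairwise unreliabilities in `A` at most `s`; threshold `k ≤ |A|` with `k + |F| ≤ |A| + 1` (so that `N_a < k`
forces at least `max(1, |F|)` lost relay points).  Then `μ(N_a < k) ≤ (3/2)·s` for every `a ∈ A`.  Off the glue null set: `a ∈ B₁`
loses `B₂` or all of `F` (a fixed `y ∈ F`); `a ∈ B₂` loses `B₁` or all of `F`; `a ∈ F` loses `B₁` or `B₂` — in each case two entries of a
quadruple `(y,y,z,z)`, and `Consts.real_le_three_halves_of_two_lost_ae` applies (only the elementary bound
`μ(a ↮ y ∨ a ↮ z) ≤ (3/2)s` is really used). [cite: KozmaNitzan2024, Conj. 4 (p. 32)] -/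
theorem real_blockDeficit_two_blocks_le (n : ℕ) (w : Sym2 (Fin n) → unitInterval) (A : Finset (Fin n)) (t₁ t₂ : Fin n)
    (B₁ B₂ : Finset (Fin n)) (hB₁A : B₁ ⊆ A) (hB₂A : B₂ ⊆ A) (hdisj : Disjoint B₁ B₂) (hne₁ : B₁.Nonempty) (hne₂ : B₂.Nonempty)
    (hglue₁ : ∀ b ∈ B₁, (prodBernoulli w).real (openConn t₁ b)ᶜ = 0)
    (hglue₂ : ∀ b ∈ B₂, (prodBernoulli w).real (openConn t₂ b)ᶜ = 0)
    (k : ℕ) (hkA : k ≤ A.card) (hFk : k + (A \ (B₁ ∪ B₂)).card ≤ A.card + 1)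
    {s : ℝ} (hrel : ∀ b ∈ A, ∀ b' ∈ A, (prodBernoulli w).real (openConn b b')ᶜ ≤ s) (a : Fin n) (ha : a ∈ A) :
    (prodBernoulli w).real {ω : BondConfig (Fin n) | (A.filter fun b => ω ∈ openConn a b).card < k} ≤ 3 / 2 * s := by
  set μ := prodBernoulli w with hμ
  set F := A \ (B₁ ∪ B₂) with hF
  -- the glue null set of both blocks
  set Z : Set (BondConfig (Fin n)) := (⋃ b ∈ B₁, (openConn t₁ b)ᶜ) ∪ ⋃ b ∈ B₂, (openConn t₂ b)ᶜ with hZdef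
  have hZ0 : μ.real Z = 0 := by
    refine le_antisymm ?_ measureReal_nonneg
    calc μ.real Z ≤ μ.real (⋃ b ∈ B₁, (openConn t₁ b)ᶜ) + μ.real (⋃ b ∈ B₂, (openConn t₂ b)ᶜ) := measureReal_union_le _ _
      _ = 0 := by
        rw [real_biUnion_compl_openConn_eq_zero n w t₁ B₁ hglue₁, real_biUnion_compl_openConn_eq_zero n w t₂ B₂ hglue₂, add_zero]
  have hoff₁ : ∀ ω : BondConfig (Fin n), ω ∈ Zᶜ → ∀ b ∈ B₁, ω ∈ openConn t₁ b := by
    intro ω hω b hb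
    by_contra h
    exact hω (Or.inl (Set.mem_iUnion₂.2 ⟨b, hb, h⟩))
  have hoff₂ : ∀ ω : BondConfig (Fin n), ω ∈ Zᶜ → ∀ b ∈ B₂, ω ∈ openConn t₂ b := by
    intro ω hω b hb
    by_contra h
    exact hω (Or.inr (Set.mem_iUnion₂.2 ⟨b, hb, h⟩))
  -- off `Z`: a point joined to one point of a block is joined to the whole block
  have hblock₁ : ∀ ω : BondConfig (Fin n), ω ∈ Zᶜ → ∀ b ∈ B₁, ω ∈ openConn a b → ∀ b' ∈ B₁, ω ∈ openConn a b' :=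
    fun ω hω b hb hab b' hb' => SimpleGraph.Reachable.trans hab
      (SimpleGraph.Reachable.trans (SimpleGraph.Reachable.symm (hoff₁ ω hω b hb)) (hoff₁ ω hω b' hb'))
  have hblock₂ : ∀ ω : BondConfig (Fin n), ω ∈ Zᶜ → ∀ b ∈ B₂, ω ∈ openConn a b → ∀ b' ∈ B₂, ω ∈ openConn a b' :=
    fun ω hω b hb hab b' hb' => SimpleGraph.Reachable.trans hab
      (SimpleGraph.Reachable.trans (SimpleGraph.Reachable.symm (hoff₂ ω hω b hb)) (hoff₂ ω hω b' hb'))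
  obtain ⟨b₁, hb₁⟩ := hne₁
  obtain ⟨b₂, hb₂⟩ := hne₂
  have hb₁2 : b₁ ∉ B₂ := Finset.disjoint_left.1 hdisj hb₁
  have hb₂1 : b₂ ∉ B₁ := Finset.disjoint_right.1 hdisj hb₂
  -- if `a` keeps both blocks and `N_a < k`, then `a ∉ F` and every free point is lost (the free part is then nonempty)
  have hkeep_both : ∀ ω : BondConfig (Fin n), (∀ b ∈ B₁ ∪ B₂, ω ∈ openConn a b) →
      (A.filter fun b => ω ∈ openConn a b).card < k →
      a ∉ F ∧ ∀ y, (F.Nonempty → y ∈ F) → ω ∉ openConn a y := by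
    intro ω hB hN
    obtain ⟨hsub, hcard⟩ := lostSet_sub_free_of_blocks_kept A B₁ B₂ a ω hB k hN
    rw [← hF] at hsub
    have hle := Finset.card_le_card hsub
    by_cases haF : a ∈ F
    · rw [Finset.card_erase_of_mem haF] at hle
      omega
    · refine ⟨haF, fun y hyF hy => ?_⟩
      rw [Finset.erase_eq_of_notMem haF] at hle
      have hFne : F.Nonempty := by rw [← Finset.card_pos]; omega
      have hyF' := hyF hFne
      have hsub' : (A.filter fun b => ω ∉ openConn a b) ⊆ F.erase y := by
        intro b hb
        refine Finset.mem_erase.2 ⟨?_, Finset.mem_of_mem_erase (hsub hb)⟩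
        rintro rfl
        exact (Finset.mem_filter.1 hb).2 hy
      have hle' := Finset.card_le_card hsub'
      rw [Finset.card_erase_of_mem hyF'] at hle'
      omega
  -- free points for the two block cases (outside the respective block)
  obtain ⟨y₁, hy₁A, hy₁F, hy₁B⟩ : ∃ y : Fin n, y ∈ A ∧ (F.Nonempty → y ∈ F) ∧ y ∉ B₁ := by
    by_cases hne : F.Nonempty
    · obtain ⟨y, hy⟩ := hne
      have hy' := Finset.mem_sdiff.1 hy
      exact ⟨y, hy'.1, fun _ => hy, fun h => hy'.2 (Finset.mem_union_left _ h)⟩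
    · exact ⟨b₂, hB₂A hb₂, fun h => absurd h hne, hb₂1⟩
  obtain ⟨y₂, hy₂A, hy₂F, hy₂B⟩ : ∃ y : Fin n, y ∈ A ∧ (F.Nonempty → y ∈ F) ∧ y ∉ B₂ := by
    by_cases hne : F.Nonempty
    · obtain ⟨y, hy⟩ := hne
      have hy' := Finset.mem_sdiff.1 hy
      exact ⟨y, hy'.1, fun _ => hy, fun h => hy'.2 (Finset.mem_union_right _ h)⟩
    · exact ⟨b₁, hB₁A hb₁, fun h => absurd h hne, hb₁2⟩
  by_cases ha₁ : a ∈ B₁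
  · -- `a ∈ B₁`: quadruple `(b₂, b₂, y₁, y₁)`
    have hb₂a : b₂ ≠ a := fun h => hb₂1 (h ▸ ha₁)
    have hy₁a : y₁ ≠ a := fun h => hy₁B (h ▸ ha₁)
    refine real_le_three_halves_of_two_lost_ae n w A a ha hrel ![b₂, b₂, y₁, y₁]
      (fun j => by fin_cases j <;> simp [hB₂A hb₂, hy₁A]) (fun j => by fin_cases j <;> simp [hb₂a, hy₁a]) Z _ hZ0 ?_
    rintro ω ⟨hN, hωZ⟩
    simp only [mem_setOf_eq] at hN ⊢
    by_cases hab : ω ∈ openConn a b₂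
    · have hB : ∀ b ∈ B₁ ∪ B₂, ω ∈ openConn a b := by
        intro b hb
        rcases Finset.mem_union.1 hb with hb | hb
        · exact hblock₁ ω hωZ a ha₁ (SimpleGraph.Reachable.refl _) b hb
        · exact hblock₂ ω hωZ b₂ hb₂ hab b hb
      have hy := (hkeep_both ω hB hN).2 y₁ hy₁F
      refine Finset.one_lt_card.2 ⟨2, ?_, 3, ?_, by decide⟩ <;> simp [hy]
    · refine Finset.one_lt_card.2 ⟨0, ?_, 1, ?_, by decide⟩ <;> simp [hab]
  by_cases ha₂ : a ∈ B₂
  · -- `a ∈ B₂`: quadruple `(b₁, b₁, y₂, y₂)`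
    have hb₁a : b₁ ≠ a := fun h => hb₁2 (h ▸ ha₂)
    have hy₂a : y₂ ≠ a := fun h => hy₂B (h ▸ ha₂)
    refine real_le_three_halves_of_two_lost_ae n w A a ha hrel ![b₁, b₁, y₂, y₂]
      (fun j => by fin_cases j <;> simp [hB₁A hb₁, hy₂A]) (fun j => by fin_cases j <;> simp [hb₁a, hy₂a]) Z _ hZ0 ?_
    rintro ω ⟨hN, hωZ⟩
    simp only [mem_setOf_eq] at hN ⊢
    by_cases hab : ω ∈ openConn a b₁
    · have hB : ∀ b ∈ B₁ ∪ B₂, ω ∈ openConn a b := by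
        intro b hb
        rcases Finset.mem_union.1 hb with hb | hb
        · exact hblock₁ ω hωZ b₁ hb₁ hab b hb
        · exact hblock₂ ω hωZ a ha₂ (SimpleGraph.Reachable.refl _) b hb
      have hy := (hkeep_both ω hB hN).2 y₂ hy₂F
      refine Finset.one_lt_card.2 ⟨2, ?_, 3, ?_, by decide⟩ <;> simp [hy]
    · refine Finset.one_lt_card.2 ⟨0, ?_, 1, ?_, by decide⟩ <;> simp [hab]
  · -- `a` free: quadruple `(b₁, b₁, b₂, b₂)`; `a` cannot keep both blocks
    have haF : a ∈ F := Finset.mem_sdiff.2 ⟨ha, fun h => (Finset.mem_union.1 h).elim ha₁ ha₂⟩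
    have hb₁a : b₁ ≠ a := fun h => ha₁ (h ▸ hb₁)
    have hb₂a : b₂ ≠ a := fun h => ha₂ (h ▸ hb₂)
    refine real_le_three_halves_of_two_lost_ae n w A a ha hrel ![b₁, b₁, b₂, b₂]
      (fun j => by fin_cases j <;> simp [hB₁A hb₁, hB₂A hb₂]) (fun j => by fin_cases j <;> simp [hb₁a, hb₂a]) Z _ hZ0 ?_
    rintro ω ⟨hN, hωZ⟩
    simp only [mem_setOf_eq] at hN ⊢
    by_cases hab₁ : ω ∈ openConn a b₁
    · by_cases hab₂ : ω ∈ openConn a b₂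
      · have hB : ∀ b ∈ B₁ ∪ B₂, ω ∈ openConn a b := by
          intro b hb
          rcases Finset.mem_union.1 hb with hb | hb
          · exact hblock₁ ω hωZ b₁ hb₁ hab₁ b hb
          · exact hblock₂ ω hωZ b₂ hb₂ hab₂ b hb
        exact absurd haF (hkeep_both ω hB hN).1
      · refine Finset.one_lt_card.2 ⟨2, ?_, 3, ?_, by decide⟩ <;> simp [hab₂]
    · refine Finset.one_lt_card.2 ⟨0, ?_, 1, ?_, by decide⟩ <;> simp [hab₁]

/-! ### (LT³⁄₂) for the classes -/

/-- `κ·EN ≤ k` for the threshold `k = |A| − ⌊|A|/3⌋` (`0 < κ ≤ 2/3`, `EN ≤ |A|`), so the bad event `{1 ≤ N < κ·EN}` lies in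
`{1 ≤ N < k}`. [folklore] -/
theorem lowerTail_subset_threshold (n : ℕ) (w : Sym2 (Fin n) → unitInterval) (A : Finset (Fin n)) (o : Fin n) {κ : ℝ}
    (hκ0 : 0 < κ) (hκ : κ ≤ 2 / 3) :
    {ω : BondConfig (Fin n) | 1 ≤ (A.filter fun a => ω ∈ openConn o a).card ∧
        ((A.filter fun a => ω ∈ openConn o a).card : ℝ) < κ * (∑ a ∈ A, (prodBernoulli w).real (openConn o a))} ⊆
      {ω : BondConfig (Fin n) | 1 ≤ (A.filter fun b => ω ∈ openConn o b).card ∧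
        (A.filter fun b => ω ∈ openConn o b).card < A.card - A.card / 3} := by
  intro ω hω
  simp only [mem_setOf_eq] at hω ⊢
  obtain ⟨h1, hlt⟩ := hω
  refine ⟨h1, ?_⟩
  have hEN : (∑ a ∈ A, (prodBernoulli w).real (openConn o a)) ≤ A.card := sum_real_openConn_le_card n w A o
  have hk3 : A.card / 3 ≤ A.card := Nat.div_le_self _ _
  have hcast : ((A.card - A.card / 3 : ℕ) : ℝ) = (A.card : ℝ) - ((A.card / 3 : ℕ) : ℝ) := by rw [Nat.cast_sub hk3]
  have hdiv : ((A.card / 3 : ℕ) : ℝ) ≤ (A.card : ℝ) / 3 := Nat.cast_div_le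
  have hkr : κ * (∑ a ∈ A, (prodBernoulli w).real (openConn o a)) ≤ ((A.card - A.card / 3 : ℕ) : ℝ) := by
    rw [hcast]
    calc κ * (∑ a ∈ A, (prodBernoulli w).real (openConn o a)) ≤ κ * A.card := mul_le_mul_of_nonneg_left hEN hκ0.le
      _ ≤ 2 / 3 * A.card := mul_le_mul_of_nonneg_right hκ (by positivity)
      _ ≤ (A.card : ℝ) - ((A.card / 3 : ℕ) : ℝ) := by linarith
  have : ((A.filter fun a => ω ∈ openConn o a).card : ℝ) < ((A.card - A.card / 3 : ℕ) : ℝ) := lt_of_lt_of_le hlt hkr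
  exact_mod_cast this

/-- **(LT³⁄₂) for two glued blocks, ANY observer, every `0 < κ ≤ 2/3`** (all finite weighted graphs, all `s`): disjoint nonempty
`B₁, B₂ ⊆ A` almost surely glued to vertices `t₁, t₂`, free part `F = A ∖ (B₁ ∪ B₂)` with `2·|F| ≤ |B₁| + |B₂| + 3`.  Then
`P(1 ≤ N < κ·EN) ≤ (3/2)·s`.  (`|A| ≤ 6`: `…_of_card_le_six_any`; else footprint transfer `Consts.lowerTail_le_blockDeficit` at
`k = |A| − ⌊|A|/3⌋` and `Consts.real_blockDeficit_two_blocks_le`, whose hypothesis `k + |F| ≤ |A| + 1` is `|F| ≤ ⌊|A|/3⌋ + 1`, i.e.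
the stated condition.)  Three more free points than two marked points carrying `(2/3)|A|` (`…GluedFraction`) would allow.
[cite: KozmaNitzan2024, Conj. 1 (p. 3)] -/
theorem real_lowerTail_le_three_halves_of_two_glued_blocks (n : ℕ) (w : Sym2 (Fin n) → unitInterval) (A : Finset (Fin n))
    (o t₁ t₂ : Fin n) (B₁ B₂ : Finset (Fin n)) (hB₁A : B₁ ⊆ A) (hB₂A : B₂ ⊆ A) (hdisj : Disjoint B₁ B₂)
    (hne₁ : B₁.Nonempty) (hne₂ : B₂.Nonempty)
    (hglue₁ : ∀ b ∈ B₁, (prodBernoulli w).real (openConn t₁ b)ᶜ = 0)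
    (hglue₂ : ∀ b ∈ B₂, (prodBernoulli w).real (openConn t₂ b)ᶜ = 0)
    (hF : 2 * (A \ (B₁ ∪ B₂)).card ≤ B₁.card + B₂.card + 3) {κ s : ℝ} (hκ0 : 0 < κ) (hκ : κ ≤ 2 / 3) (hs : 0 ≤ s)
    (hrel : ∀ a ∈ A, ∀ a' ∈ A, (prodBernoulli w).real (openConn a a')ᶜ ≤ s) :
    (prodBernoulli w).real {ω : BondConfig (Fin n) | 1 ≤ (A.filter fun a => ω ∈ openConn o a).card ∧
        ((A.filter fun a => ω ∈ openConn o a).card : ℝ) < κ * (∑ a ∈ A, (prodBernoulli w).real (openConn o a))} ≤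
      3 / 2 * s := by
  by_cases hA6 : A.card ≤ 6
  · exact real_lowerTail_le_three_halves_of_card_le_six_any n w A o hA6 hκ0 hκ hs hrel
  set μ := prodBernoulli w with hμ
  have hFA := Finset.card_sdiff_add_card_eq_card (Finset.union_subset hB₁A hB₂A)
  have hU : (B₁ ∪ B₂).card = B₁.card + B₂.card := Finset.card_union_of_disjoint hdisj
  set k : ℕ := A.card - A.card / 3 with hk
  have hk3 : A.card / 3 ≤ A.card := Nat.div_le_self _ _
  have hkA : k ≤ A.card := by omega
  have hFk : k + (A \ (B₁ ∪ B₂)).card ≤ A.card + 1 := by omega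
  have hblk : ∀ a ∈ A, μ.real {ω : BondConfig (Fin n) | (A.filter fun b => ω ∈ openConn a b).card < k} ≤ 3 / 2 * s :=
    fun a ha => real_blockDeficit_two_blocks_le n w A t₁ t₂ B₁ B₂ hB₁A hB₂A hdisj hne₁ hne₂ hglue₁ hglue₂ k hkA hFk hrel a ha
  have htr := lowerTail_le_blockDeficit n w A o k (3 / 2 * s) hblk
  have h32 : 3 / 2 * s * μ.real (⋃ a ∈ A, openConn o a) ≤ 3 / 2 * s := by
    have h0 : 0 ≤ 3 / 2 * s := by linarith
    have h1 : μ.real (⋃ a ∈ A, openConn o a) ≤ 1 := measureReal_le_one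
    nlinarith [measureReal_nonneg (μ := μ) (s := ⋃ a ∈ A, openConn o a)]
  exact le_trans (measureReal_mono (lowerTail_subset_threshold n w A o hκ0 hκ)) (htr.trans h32)

/-- **(LT³⁄₂) for one glued block carrying all but at most half-itself-plus-three of the relay points**, any observer, every
`0 < κ ≤ 2/3`: `B ⊆ A` almost surely glued to `t`, `2·|A ∖ B| ≤ |B| + 6` ⇒ `P(1 ≤ N < κ·EN) ≤ (3/2)·s`.  (A free point serves as the
second block of `Consts.real_lowerTail_le_three_halves_of_two_glued_blocks`; no free point: `…_of_glued_block`.)  Contains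
`Consts.real_lowerTail_le_three_halves_of_glued_block` (`|A ∖ B| ≤ 4`). [cite: KozmaNitzan2024, Conj. 1 (p. 3)] -/
theorem real_lowerTail_le_three_halves_of_glued_block_half (n : ℕ) (w : Sym2 (Fin n) → unitInterval) (A : Finset (Fin n))
    (o t : Fin n) (B : Finset (Fin n)) (hBA : B ⊆ A) (hglue : ∀ b ∈ B, (prodBernoulli w).real (openConn t b)ᶜ = 0)
    (hF : 2 * (A \ B).card ≤ B.card + 6) {κ s : ℝ} (hκ0 : 0 < κ) (hκ : κ ≤ 2 / 3) (hs : 0 ≤ s)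
    (hrel : ∀ a ∈ A, ∀ a' ∈ A, (prodBernoulli w).real (openConn a a')ᶜ ≤ s) :
    (prodBernoulli w).real {ω : BondConfig (Fin n) | 1 ≤ (A.filter fun a => ω ∈ openConn o a).card ∧
        ((A.filter fun a => ω ∈ openConn o a).card : ℝ) < κ * (∑ a ∈ A, (prodBernoulli w).real (openConn o a))} ≤
      3 / 2 * s := by
  by_cases hA6 : A.card ≤ 6
  · exact real_lowerTail_le_three_halves_of_card_le_six_any n w A o hA6 hκ0 hκ hs hrel
  by_cases hFe : (A \ B).Nonempty
  · obtain ⟨d, hd⟩ := hFe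
    have hd' := Finset.mem_sdiff.1 hd
    have hBne : B.Nonempty := by
      rw [← Finset.card_pos]
      have := Finset.card_sdiff_add_card_eq_card hBA
      have hle : (A \ B).card ≤ A.card := Finset.card_le_card Finset.sdiff_subset
      omega
    have hdisj : Disjoint B {d} := Finset.disjoint_singleton_right.2 hd'.2
    refine real_lowerTail_le_three_halves_of_two_glued_blocks n w A o t d B {d} hBA (Finset.singleton_subset_iff.2 hd'.1)
      hdisj hBne (Finset.singleton_nonempty d) hglue ?_ ?_ hκ0 hκ hs hrel
    · intro b hb
      rw [Finset.mem_singleton.1 hb]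
      have : (openConn d d : Set (BondConfig (Fin n))) = univ := Set.eq_univ_of_forall fun ω => SimpleGraph.Reachable.refl _
      rw [this, Set.compl_univ, measureReal_empty]
    · have h1 : A \ (B ∪ {d}) = (A \ B).erase d := by
        ext b
        simp only [Finset.mem_sdiff, Finset.mem_union, Finset.mem_singleton, Finset.mem_erase]
        tauto
      rw [h1, Finset.card_erase_of_mem hd, Finset.card_singleton]
      have := Finset.card_pos.2 ⟨d, hd⟩
      omega
  · have h0 : (A \ B).card = 0 := Finset.card_eq_zero.2 (Finset.not_nonempty_iff_eq_empty.1 hFe)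
    exact real_lowerTail_le_three_halves_of_glued_block n w A o t B hBA hglue (by omega) hκ0 hκ hs hrel

/-- **(LT³⁄₂) whenever two vertices `t₁, t₂` have glued blocks carrying, with one more point, two thirds of the relay set** —
`Consts.LinearLowerTailThreeHalves` restricted to the class, in its quantifier shape: if `3·#{a ∈ A : P(t₁ ↮ a) > 0 and P(t₂ ↮ a) > 0}
≤ |A| + 3`, then `P(1 ≤ N < κ·EN) ≤ (3/2)·s` for every `0 < κ ≤ 2/3` (any observer). [cite: KozmaNitzan2024, Conj. 1 (p. 3)] -/
theorem linearLowerTailThreeHalves_of_two_glued_blocks :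
    ∀ κ : ℝ, 0 < κ → κ ≤ 2 / 3 →
      ∀ (n : ℕ) (w : Sym2 (Fin n) → unitInterval) (A : Finset (Fin n)) (o : Fin n) (s : ℝ), 0 ≤ s →
        (∃ t₁ t₂ : Fin n, 3 * (A.filter fun a => 0 < (prodBernoulli w).real (openConn t₁ a)ᶜ ∧
            0 < (prodBernoulli w).real (openConn t₂ a)ᶜ).card ≤ A.card + 3) →
        (∀ a ∈ A, ∀ a' ∈ A, (prodBernoulli w).real (openConn a a')ᶜ ≤ s) →
        (prodBernoulli w).real {ω : BondConfig (Fin n) | 1 ≤ (A.filter fun a => ω ∈ openConn o a).card ∧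
            ((A.filter fun a => ω ∈ openConn o a).card : ℝ) < κ * (∑ a ∈ A, (prodBernoulli w).real (openConn o a))} ≤
          3 / 2 * s := by
  intro κ hκ0 hκ n w A o s hs ht hrel
  obtain ⟨t₁, t₂, ht3⟩ := ht
  set μ := prodBernoulli w with hμ
  -- blocks: glued to `t₁`; glued to `t₂` but not to `t₁`
  set B₁ := A.filter fun a => μ.real (openConn t₁ a)ᶜ = 0 with hB₁
  set B₂ := A.filter fun a => μ.real (openConn t₂ a)ᶜ = 0 ∧ ¬ μ.real (openConn t₁ a)ᶜ = 0 with hB₂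
  have hB₁A : B₁ ⊆ A := Finset.filter_subset _ _
  have hB₂A : B₂ ⊆ A := Finset.filter_subset _ _
  have hdisj : Disjoint B₁ B₂ := by
    rw [Finset.disjoint_left]
    intro b hb₁ hb₂
    exact (Finset.mem_filter.1 hb₂).2.2 (Finset.mem_filter.1 hb₁).2
  have hglue₁ : ∀ b ∈ B₁, μ.real (openConn t₁ b)ᶜ = 0 := fun b hb => (Finset.mem_filter.1 hb).2
  have hglue₂ : ∀ b ∈ B₂, μ.real (openConn t₂ b)ᶜ = 0 := fun b hb => (Finset.mem_filter.1 hb).2.1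
  -- the free part is the filtered set of the hypothesis
  have hFeq : A \ (B₁ ∪ B₂) = A.filter fun a => 0 < μ.real (openConn t₁ a)ᶜ ∧ 0 < μ.real (openConn t₂ a)ᶜ := by
    ext a
    simp only [Finset.mem_sdiff, Finset.mem_union, Finset.mem_filter, hB₁, hB₂]
    constructor
    · rintro ⟨haA, hnot⟩
      have h1 : ¬ μ.real (openConn t₁ a)ᶜ = 0 := fun h => hnot (Or.inl ⟨haA, h⟩)
      have h2 : ¬ μ.real (openConn t₂ a)ᶜ = 0 := fun h => hnot (Or.inr ⟨haA, h, h1⟩)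
      exact ⟨haA, lt_of_le_of_ne measureReal_nonneg (Ne.symm h1), lt_of_le_of_ne measureReal_nonneg (Ne.symm h2)⟩
    · rintro ⟨haA, h1, h2⟩
      refine ⟨haA, ?_⟩
      rintro (⟨_, h⟩ | ⟨_, h, _⟩)
      · exact absurd h (ne_of_gt h1)
      · exact absurd h (ne_of_gt h2)
  have hFcard : 3 * (A \ (B₁ ∪ B₂)).card ≤ A.card + 3 := by rw [hFeq]; exact ht3
  have hFA := Finset.card_sdiff_add_card_eq_card (Finset.union_subset hB₁A hB₂A)
  have hU : (B₁ ∪ B₂).card = B₁.card + B₂.card := Finset.card_union_of_disjoint hdisj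
  by_cases hA6 : A.card ≤ 6
  · exact real_lowerTail_le_three_halves_of_card_le_six_any n w A o hA6 hκ0 hκ hs hrel
  by_cases hne₂ : B₂.Nonempty
  · by_cases hne₁ : B₁.Nonempty
    · exact real_lowerTail_le_three_halves_of_two_glued_blocks n w A o t₁ t₂ B₁ B₂ hB₁A hB₂A hdisj hne₁ hne₂ hglue₁ hglue₂
        (by omega) hκ0 hκ hs hrel
    · -- only the second block: one-block theorem for `B₂`
      have h1 : B₁.card = 0 := Finset.card_eq_zero.2 (Finset.not_nonempty_iff_eq_empty.1 hne₁)
      have hsd : (A \ B₂).card + B₂.card = A.card := Finset.card_sdiff_add_card_eq_card hB₂A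
      exact real_lowerTail_le_three_halves_of_glued_block_half n w A o t₂ B₂ hB₂A hglue₂ (by omega) hκ0 hκ hs hrel
  · -- only the first block
    have h2 : B₂.card = 0 := Finset.card_eq_zero.2 (Finset.not_nonempty_iff_eq_empty.1 hne₂)
    have hsd : (A \ B₁).card + B₁.card = A.card := Finset.card_sdiff_add_card_eq_card hB₁A
    exact real_lowerTail_le_three_halves_of_glued_block_half n w A o t₁ B₁ hB₁A hglue₁ (by omega) hκ0 hκ hs hrel

/-- **(LT³⁄₂) whenever some vertex `t` has a glued block `B` with `2·|A ∖ B| ≤ |B| + 6`** — in the quantifier shape of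
`Consts.LinearLowerTailThreeHalves`: if `3·#{a ∈ A : P(t ↮ a) > 0} ≤ |A| + 6` then `P(1 ≤ N < κ·EN) ≤ (3/2)·s` for every
`0 < κ ≤ 2/3` (any observer). [cite: KozmaNitzan2024, Conj. 1 (p. 3)] -/
theorem linearLowerTailThreeHalves_of_glued_block_half :
    ∀ κ : ℝ, 0 < κ → κ ≤ 2 / 3 →
      ∀ (n : ℕ) (w : Sym2 (Fin n) → unitInterval) (A : Finset (Fin n)) (o : Fin n) (s : ℝ), 0 ≤ s →
        (∃ t : Fin n, 3 * (A.filter fun a => 0 < (prodBernoulli w).real (openConn t a)ᶜ).card ≤ A.card + 6) →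
        (∀ a ∈ A, ∀ a' ∈ A, (prodBernoulli w).real (openConn a a')ᶜ ≤ s) →
        (prodBernoulli w).real {ω : BondConfig (Fin n) | 1 ≤ (A.filter fun a => ω ∈ openConn o a).card ∧
            ((A.filter fun a => ω ∈ openConn o a).card : ℝ) < κ * (∑ a ∈ A, (prodBernoulli w).real (openConn o a))} ≤
          3 / 2 * s := by
  intro κ hκ0 hκ n w A o s hs ht hrel
  obtain ⟨t, ht3⟩ := ht
  set Fr := A.filter fun a => 0 < (prodBernoulli w).real (openConn t a)ᶜ with hFr
  have hFrA : Fr ⊆ A := Finset.filter_subset _ _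
  have hsd : A \ (A \ Fr) = Fr := Finset.sdiff_sdiff_eq_self hFrA
  have hcard := Finset.card_sdiff_add_card_eq_card hFrA
  refine real_lowerTail_le_three_halves_of_glued_block_half n w A o t (A \ Fr) Finset.sdiff_subset ?_ ?_ hκ0 hκ hs hrel
  · intro b hb
    have hb' := Finset.mem_sdiff.1 hb
    have hnot : ¬ 0 < (prodBernoulli w).real (openConn t b)ᶜ := fun h => hb'.2 (Finset.mem_filter.2 ⟨hb'.1, h⟩)
    exact le_antisymm (not_lt.1 hnot) measureReal_nonneg
  · rw [hsd]
    omega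

end Consts

end Summit.CriticalPhenomena.PercolationContinuityZ3.Theorems
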